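import Summits.QuantumFields.YangMills.Theorems.BalabanUVNodesN11SpaceTruncationBorelB

/-!
# DAG node N11 — door (d4) AT THE SEPARATED INDICES OF THE RECORD: the background proviso on the reading support FROM the record row `bg` (separated support),
# a junction at SEPARATED indices, and the print-void residue at non-separated indices DISPLAYED (supersedes p589738's vacuous-prone corollary)

HEADER — WORK-UNIT METADATA.  Cell `pub-ymgap`, YM-PLAN Track A (HUMAN RULING D-0062), seat `pub-ymgap-dag-n11-d` (g11; R134 fan-out seat N11 [B14], strategy s2),
route `BalabanUVNodes`, item K1⁷ `StabilityBAtRecordR13SepCoPH` = stmt-QuantumFields-20542 (helper, `--kind proof --supports 20542 --as helper`, count-neutral).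
[III] = [Balaban1988Convergent], [6] = [Balaban1985RegularSpaces].  Over p589738 `…N11SpaceTruncation` (★★★ `exists_local_witness_clause_succ_of_sLaw₁₃CoPH_of_bgRead`),
this seat's `…N11SpaceTruncationBorelB` (★★★★ the witness-first face), def-T's `Record13SepCoPH` (row `Provisos₁₃SepCoPH.bg`, `suppOfRecord₁₃SepCoP`, `PartCompat₁₃`),
def-R's `BgProvisoΛ`, `Record12BgRowAnalysis` (`Sect2.SeqSeparated`).

WHY THIS FILE (an ERRATUM made good).  p589738's corollary `…_of_sep_of_junction` asked its junction «reading support ⊆ separated (7)-regular support» at EVERY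
index `s₀ : SeqOfRecord … k`; at a NON-separated index the separated support is EMPTY (`Record13` §9) while the reading support is not, so that hypothesis is
unsatisfiable as soon as a non-separated index exists — the corollary asserts nothing false but is vacuous-prone and must not be cited.  The tree's index type
carries the inclusions of (2.1) only; print's sequences are separated ([6] (1.3)–(1.6); `Record12BgRowAnalysis` :461 «every row quantified ∀ s is print-stronger
by exactly this predicate»).  The honest split of the background hypothesis of door (d4) is therefore THREE-WAY: (i) the record row `bg` (def-R's `BgProvisoΛ` over
`suppOfRecord₁₃SepCoP`, under the window and `PartCompat₁₃`); (ii) the JUNCTION AT SEPARATED INDICES «χ-support × lower-scale regularity on the reading regions ⊆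
separated (7)-regular support» (def-R's located R-half of [RFACE-11d]: top-scale regularity from `χ_k(s) ≠ 0`, the (7)-data `DataSmall7PTop`) — a K0 ∕ def-R row;
(iii) at NON-separated indices the reading-support proviso itself, DISPLAYED — print-void (such indices do not occur in (2.18)), supplied by no record row, a
typing residue of the index set (def-T ∕ K0 decide: restrict the §2 clause to separated indices, or pin the slots to `0` off them).

WHAT THIS FILE PROVES (0 `sorry`, 0 `def`; pure logic over the two faces).
* `bgProvisoΛ_read_of_sep_of_junction_of_nonSep` — (i) + (ii) + (iii) ⇒ `BgProvisoΛ` over the reading support.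
* ★ `exists_local_witness_clause_succ_of_sLaw₁₃CoPH_of_sep_of_sepJunction` — p589738's ★★★ keyed on (i)–(iii).
* ★ `exists_local_witness_clause_succ_of_hasSect2FormAtZS_of_borelB_of_sep_of_sepJunction` — the witness-first ★★★★ keyed on (i)–(iii).
* `sepJunction_of_top` — for print's reading regions (`readSelOfSeq`, letter `θ.s2.cR`), (ii) IS a top-scale statement: the lower clauses of the reading support
  are the collar and `Γ_j` clauses of def-R's support; displayed remains «`χ_k(s₀)(W_k) ≠ 0 ⇒` top regularity ∧ (7)-data» (`hTop`).

HONEST FRAMING.  Helper lane of K1⁷; bookkeeping; nothing of Bałaban's is asserted; (ii) and (iii) are HYPOTHESES (K0 ∕ def-R ∕ def-T rows), not proved here.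
N11 NOT discharged; K1⁷ NOT closed; counts unmoved (typed 28∕28 · discharged 5∕27).  One finite four-torus programme at fixed `ε = L^{−K}` — NOT ℝ⁴, NOT OS, NOT a
mass gap, NOT Clay.  No `sorry`, `axiom`, `def`, `instance`, `notation`.  Sources (SHAPE only): [III] (2.1) p.254, (2.7) p.255, (2.10) p.256, (2.18) p.257, (2.28) p.259,
Thm 1 p.262, (3.24)–(3.25) p.270; [6] (1.3)–(1.6) p.77.
-/

noncomputable section

open MeasureTheory
open scoped BigOperators ENNReal NNReal Matrix.Norms.L2Operator

namespace Summit.QuantumFields.YangMills.Theorems.BalabanUVNodesN11SpaceTruncationAtSepIndices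

open Literature.MathematicalPhysics.QuantumFieldTheory.Balaban1983to89 T4Continuum T4NestedCovariance Node00 Node00.Tk DagBinding
open B15DeterminingSets B8Eq17ClassAkV1
open BalabanUVNodesN11FluctTruncationDefs (IsFluctLocal truncTermValues)
open BalabanUVNodesN11SpaceTruncationDefs BalabanUVNodesN11SpaceTruncationBorelBDefs
open BalabanUVNodesN11SpaceTruncation (exists_local_witness_clause_succ_of_sLaw₁₃CoPH_of_bgRead)
open BalabanUVNodesN11SpaceTruncationBorelB (exists_local_witness_clause_succ_of_hasSect2FormAtZS_of_borelB_of_bgRead)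

variable {F : T4Family} {N : ℕ} [NeZero N]

variable (θ : Stage13HParams F N) (p : B12.RunParams)

/-- **THE THREE-WAY SPLIT**: def-R's `BgProvisoΛ` over the separated (7)-regular support (record row `bg`), the junction at SEPARATED indices, and the
reading-support proviso at NON-separated indices (print-void, displayed) give `BgProvisoΛ` over the reading support at every index.
[cite: Balaban1988Convergent, (2.28) p.259, (2.10) p.256, (2.1) p.254; Balaban1985RegularSpaces, (1.3)–(1.6) p.77] -/
theorem bgProvisoΛ_read_of_sep_of_junction_of_nonSep {k : ℕ} (cR : ℝ)
    (Γr : SeqOfRecord F θ.ν θ.τ9.M (gOfRecord₁₃ F N θ.toStage13Params p) p.K k → ℕ → Set (Site (F.P p.K) 0) → Set (Site (F.P p.K) 0))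
    (hsep : BgProvisoΛ F N p.K (settingOfRecord₁₃ F N θ.toStage13Params p) (θ.Rz p.K) θ.τ9.M k (suppOfRecord₁₃SepCoP F N θ.toStage13Params p k)
      (UbgOfRecord₁₃CoP F N θ.toStage13Params p k))
    (hJ : ∀ s₀, Sect2.SeqSeparated θ.ν.M₁ s₀ → ∀ Wc : MSField (F.P p.K) (SU N),
      chiSeqOfRecord F N θ.ν θ.τ9.M (gOfRecord₁₃ F N θ.toStage13Params p) p.K k s₀ (Wc k) ≠ 0 →
      (∀ j, j < k → PlaqSmallOn (plaqsOf (pts j (Γr s₀ j (s₀.Ω (j + 1))ᶜ))) (cR * epsOfRecord θ.ν (gOfRecord₁₃ F N θ.toStage13Params p) j) (Wc j)) →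
      Wc ∈ suppOfRecord₁₃SepCoP F N θ.toStage13Params p k s₀)
    (hNS : ∀ s₀, ¬ Sect2.SeqSeparated θ.ν.M₁ s₀ → ∀ Wc : MSField (F.P p.K) (SU N),
      chiSeqOfRecord F N θ.ν θ.τ9.M (gOfRecord₁₃ F N θ.toStage13Params p) p.K k s₀ (Wc k) ≠ 0 →
      (∀ j, j < k → PlaqSmallOn (plaqsOf (pts j (Γr s₀ j (s₀.Ω (j + 1))ᶜ))) (cR * epsOfRecord θ.ν (gOfRecord₁₃ F N θ.toStage13Params p) j) (Wc j)) →
      ∀ j, 1 ≤ j → j ≤ k → ∀ X : (Sect2.domSys (F.P p.K) θ.τ9.M j).Dom,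
        (Sect2.domSites (F.P p.K) θ.τ9.M j X ⊆ s₀.Λ j →
          Sect2.ofBackgroundC (settingOfRecord₁₃ F N θ.toStage13Params p).ι (UbgOfRecord₁₃CoP F N θ.toStage13Params p k s₀ Wc) ∈
            Sect2.spaceI (settingOfRecord₁₃ F N θ.toStage13Params p) (θ.Rz p.K) θ.τ9.M j (Sect2.domSites (F.P p.K) θ.τ9.M j X)
              ((settingOfRecord₁₃ F N θ.toStage13Params p).lf.alpha0 ((settingOfRecord₁₃ F N θ.toStage13Params p).flow.g j))
              ((settingOfRecord₁₃ F N θ.toStage13Params p).lf.alpha1 ((settingOfRecord₁₃ F N θ.toStage13Params p).flow.g j))) ∧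
        (Sect2.admB (F.P p.K) θ.ν θ.τ9.M (gOfRecord₁₃ F N θ.toStage13Params p) s₀.Ω s₀.Λ j (Sect2.domSites (F.P p.K) θ.τ9.M j X) = true →
          Sect2.ofBackgroundC (settingOfRecord₁₃ F N θ.toStage13Params p).ι (UbgOfRecord₁₃CoP F N θ.toStage13Params p k s₀ Wc) ∈
            Sect2.spaceMS (settingOfRecord₁₃ F N θ.toStage13Params p) (θ.Rz p.K) θ.τ9.M j (Sect2.domSites (F.P p.K) θ.τ9.M j X) s₀.Ω)) :
    BgProvisoΛ F N p.K (settingOfRecord₁₃ F N θ.toStage13Params p) (θ.Rz p.K) θ.τ9.M k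
      (fun s₀ => {Wc | chiSeqOfRecord F N θ.ν θ.τ9.M (gOfRecord₁₃ F N θ.toStage13Params p) p.K k s₀ (Wc k) ≠ 0 ∧
        ∀ j, j < k → PlaqSmallOn (plaqsOf (pts j (Γr s₀ j (s₀.Ω (j + 1))ᶜ))) (cR * epsOfRecord θ.ν (gOfRecord₁₃ F N θ.toStage13Params p) j) (Wc j)})
      (UbgOfRecord₁₃CoP F N θ.toStage13Params p k) := by
  intro s₀ Wc hWc j h1 hj X
  by_cases hs : Sect2.SeqSeparated θ.ν.M₁ s₀
  · exact hsep s₀ Wc (hJ s₀ hs Wc hWc.1 hWc.2) j h1 hj X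
  · exact hNS s₀ hs Wc hWc.1 hWc.2 j h1 hj X

/-- **★ p589738's ★★★ AT THE SEPARATED INDICES OF THE RECORD**: keyed on the record row `Provisos₁₃SepCoPH.bg` (window + `PartCompat₁₃`), the junction hJ AT
SEPARATED indices, the print-void residue hNS at non-separated indices, 12a″'s `RegOn`, the run ∕ numerics rows; conclusion VERBATIM p589738's (the 𝐁 joint
measurability row kept). [cite: Balaban1988Convergent, Theorem p.245, Thm 1 p.262, (2.1) p.254, (2.7) p.255, (2.10) p.256, (2.28) p.259, (3.24)–(3.25) p.270; Balaban1985RegularSpaces, (1.3)–(1.6) p.77] -/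
theorem exists_local_witness_clause_succ_of_sLaw₁₃CoPH_of_sep_of_sepJunction (hsep : θ.Provisos₁₃SepCoPH F N) (hU : θ.ZhUnity F N) (hθ : θ.Admissible F N)
    (hpos : θ.s2.Pos) {k : ℕ} (hk : k < p.K) (hM : 1 ≤ θ.τ9.M) (hw : Step.InInterval θ.γ k (gOfRecord₁₃ F N θ.toStage13Params p))
    (hPC : PartCompat₁₃ F N θ.toStage13Params p k) (cR : ℝ)
    (Γr : SeqOfRecord F θ.ν θ.τ9.M (gOfRecord₁₃ F N θ.toStage13Params p) p.K k → ℕ → Set (Site (F.P p.K) 0) → Set (Site (F.P p.K) 0))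
    (hreg : ∀ s₀, (θ.zhAt p s₀).RegOn F N (FluctV N) θ.ν cR p (gOfRecord₁₃ F N θ.toStage13Params p) (Γr s₀))
    (hJ : ∀ s₀, Sect2.SeqSeparated θ.ν.M₁ s₀ → ∀ Wc : MSField (F.P p.K) (SU N),
      chiSeqOfRecord F N θ.ν θ.τ9.M (gOfRecord₁₃ F N θ.toStage13Params p) p.K k s₀ (Wc k) ≠ 0 →
      (∀ j, j < k → PlaqSmallOn (plaqsOf (pts j (Γr s₀ j (s₀.Ω (j + 1))ᶜ))) (cR * epsOfRecord θ.ν (gOfRecord₁₃ F N θ.toStage13Params p) j) (Wc j)) →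
      Wc ∈ suppOfRecord₁₃SepCoP F N θ.toStage13Params p k s₀)
    (hNS : ∀ s₀, ¬ Sect2.SeqSeparated θ.ν.M₁ s₀ → ∀ Wc : MSField (F.P p.K) (SU N),
      chiSeqOfRecord F N θ.ν θ.τ9.M (gOfRecord₁₃ F N θ.toStage13Params p) p.K k s₀ (Wc k) ≠ 0 →
      (∀ j, j < k → PlaqSmallOn (plaqsOf (pts j (Γr s₀ j (s₀.Ω (j + 1))ᶜ))) (cR * epsOfRecord θ.ν (gOfRecord₁₃ F N θ.toStage13Params p) j) (Wc j)) →
      ∀ j, 1 ≤ j → j ≤ k → ∀ X : (Sect2.domSys (F.P p.K) θ.τ9.M j).Dom,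
        (Sect2.domSites (F.P p.K) θ.τ9.M j X ⊆ s₀.Λ j →
          Sect2.ofBackgroundC (settingOfRecord₁₃ F N θ.toStage13Params p).ι (UbgOfRecord₁₃CoP F N θ.toStage13Params p k s₀ Wc) ∈
            Sect2.spaceI (settingOfRecord₁₃ F N θ.toStage13Params p) (θ.Rz p.K) θ.τ9.M j (Sect2.domSites (F.P p.K) θ.τ9.M j X)
              ((settingOfRecord₁₃ F N θ.toStage13Params p).lf.alpha0 ((settingOfRecord₁₃ F N θ.toStage13Params p).flow.g j))
              ((settingOfRecord₁₃ F N θ.toStage13Params p).lf.alpha1 ((settingOfRecord₁₃ F N θ.toStage13Params p).flow.g j))) ∧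
        (Sect2.admB (F.P p.K) θ.ν θ.τ9.M (gOfRecord₁₃ F N θ.toStage13Params p) s₀.Ω s₀.Λ j (Sect2.domSites (F.P p.K) θ.τ9.M j X) = true →
          Sect2.ofBackgroundC (settingOfRecord₁₃ F N θ.toStage13Params p).ι (UbgOfRecord₁₃CoP F N θ.toStage13Params p k s₀ Wc) ∈
            Sect2.spaceMS (settingOfRecord₁₃ F N θ.toStage13Params p) (θ.Rz p.K) θ.τ9.M j (Sect2.domSites (F.P p.K) θ.τ9.M j X) s₀.Ω))
    (hS : SLaw₁₃CoPH F N θ p k) :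
    ∃ (t : SeqOfRecord F θ.ν θ.τ9.M (gOfRecord₁₃ F N θ.toStage13Params p) p.K k → Sect2.TermValues (F.P p.K) (MatA N) (FluctV N) θ.τ9.M)
      (Ek : SeqOfRecord F θ.ν θ.τ9.M (gOfRecord₁₃ F N θ.toStage13Params p) p.K k → ℝ),
      HasSect2FormAtZS F N (FluctV N) p.K (settingOfRecord₁₃ F N θ.toStage13Params p) k (θ.rzAt p) (WtOfRecord₁₃H F N θ p)
          (UbgOfRecord₁₃CoP F N θ.toStage13Params p k)
          (fun s₀ t₀ => Sect2.LawsRT (sect2TowerOfRecord F N (FluctV N) p.K (settingOfRecord₁₃ F N θ.toStage13Params p) (θ.rzAt p s₀) s₀ t₀)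
            (settingOfRecord₁₃ F N θ.toStage13Params p).lf k)
          (slotsOfRecord F N θ.ν θ.τ9 (EOfRecord₁₃ F N θ.toStage13Params) (wOfRecord₉ F N θ.toStage9Params) θ.ppSel p
            (gOfRecord₁₃ F N θ.toStage13Params p) k) t Ek ∧
      (∀ s₀, IsFluctLocal k (t s₀)) ∧
      ∀ (s : SeqOfRecord F θ.ν θ.τ9.M (gOfRecord₁₃ F N θ.toStage13Params p) p.K (k + 1)), s.Ω (k + 1) = ∅ →
        -- (P) prefix agreement below `k`
        (∀ j, j < k → (θ.zhAt p s).ζ0 j = (θ.zhAt p s.init).ζ0 j ∧ (θ.zhAt p s).quad j = (θ.zhAt p s.init).quad j) →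
        -- (V) the generation-`k` pin with the old front factor
        (∀ (V' : GaugeField (F.P p.K) (k + 1) (SU N)) (U₀ : GaugeField (F.P p.K) k (SU N)),
          (θ.zhAt p s).ζ0 k Set.univ (pairCfgAt (V := FluctV N) k V' U₀) =
            chiSeqOfRecord F N θ.ν θ.τ9.M (gOfRecord₁₃ F N θ.toStage13Params p) p.K k s.init U₀ *
              wOfRecord₉ F N θ.toStage9Params p (gOfRecord₁₃ F N θ.toStage13Params p) k s U₀ ((avOfRecord F N p.K k).avg U₀)) →
        -- `quad_k(∅) = 0` on the two-scale configurations
        (∀ (V' : GaugeField (F.P p.K) (k + 1) (SU N)) (U₀ : GaugeField (F.P p.K) k (SU N)), (θ.zhAt p s).quad k ∅ (pairCfgAt (V := FluctV N) k V' U₀) = 0) →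
        -- `k`-locality of `quad_j(Λ_{j+1})`, `j < k`
        (∀ j, j < k → ∀ ω ω' : MultiCfg (F.P p.K) (SU N) (FluctV N), (∀ i, i ≤ k → ω i = ω' i) →
          (θ.zhAt p s).quad j (s.init.Λ (j + 1)) ω = (θ.zhAt p s).quad j (s.init.Λ (j + 1)) ω') →
        -- measurability of the residual serving `s′`
        (∀ j (Y : Set (Site (F.P p.K) 0)), Measurable ((θ.zhAt p s).ζ0 j Y)) →
        (∀ j (Λ' : Set (Site (F.P p.K) 0)), Measurable ((θ.zhAt p s).quad j Λ')) →
        -- per old branch: A-fibre domination (K0b)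
        (∀ S ∈ admSOfRecord F θ.ν θ.τ9.M (gOfRecord₁₃ F N θ.toStage13Params p) p.K k s.init, ∀ j : ℕ,
          ∃ ŵ : (↥(Set.toFinite (B10Eq42TorusConstraint.bondsIn j ((s.init.Λ (j + 1))ᶜ ∩ s.init.Ω (j + 1)))).toFinset → FluctV N) → ℝ≥0∞, Measurable ŵ ∧
            (∫⁻ a, ŵ a ∂(Measure.pi fun _ : ↥(Set.toFinite (B10Eq42TorusConstraint.bondsIn j ((s.init.Λ (j + 1))ᶜ ∩ s.init.Ω (j + 1)))).toFinset => (volume : Measure (FluctV N)))) ≠ ⊤ ∧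
            ∀ ω, ENNReal.ofReal ((WtOfRecord₁₃H F N θ p s).w j (s.init.Λ (j + 1)) ((s.init.Λ (j + 1))ᶜ ∩ s.init.Ω (j + 1)) (S (j + 1)) ω) ≤
              ŵ (fun b : ↥(Set.toFinite (B10Eq42TorusConstraint.bondsIn j ((s.init.Λ (j + 1))ᶜ ∩ s.init.Ω (j + 1)))).toFinset => (ω j).2 b)) →
        -- def-T: the 𝐁-terms of the witness at the parent history, READ AT THE EMBEDDED BACKGROUND, are JOINTLY measurable in `(U, A)` (LOCATED residue)
        (∀ (S' : ℕ → Set (Site (F.P p.K) 0)) (j : ℕ) (X : (Sect2.domSys (F.P p.K) θ.τ9.M j).Dom),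
          Measurable (fun q : GaugeField (F.P p.K) 0 (SU N) × MSFluct (F.P p.K) (FluctV N) =>
            ((t s.init).B j X (Sect2.ofBackgroundC (settingOfRecord₁₃ F N θ.toStage13Params p).ι q.1) (S', q.2)).re)) →
        (slotsTOfRecord F N θ.ν θ.τ9 (EOfRecord₁₃ F N θ.toStage13Params) (wOfRecord₉ F N θ.toStage9Params) θ.ppSel p
            (gOfRecord₁₃ F N θ.toStage13Params p) (k + 1) s = 0 ∨
          ∀ᵐ V' ∂fieldMeasure (F.P p.K) (k + 1) (SU N),
            chiSeqOfRecord F N θ.ν θ.τ9.M (gOfRecord₁₃ F N θ.toStage13Params p) p.K (k + 1) s V' ≠ 0 →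
              slotsTOfRecord F N θ.ν θ.τ9 (EOfRecord₁₃ F N θ.toStage13Params) (wOfRecord₉ F N θ.toStage9Params) θ.ppSel p
                  (gOfRecord₁₃ F N θ.toStage13Params p) (k + 1) s V' =
                sect2Slot F N (FluctV N) p.K (settingOfRecord₁₃ F N θ.toStage13Params p) (θ.rzAt p s) (WtOfRecord₁₃H F N θ p s) s
                  (t s.init) (Ek s.init) (UbgOfRecord₁₃CoP F N θ.toStage13Params p (k + 1) s) V') :=
  exists_local_witness_clause_succ_of_sLaw₁₃CoPH_of_bgRead θ p hsep.toCore hU hθ hpos hk hM hw cR Γr hreg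
    (bgProvisoΛ_read_of_sep_of_junction_of_nonSep θ p cR Γr (hsep.bg p k hk.le hw hPC) hJ hNS) hS

/-- **★ THE WITNESS-FIRST FACE AT THE SEPARATED INDICES OF THE RECORD**: `…SpaceTruncationBorelB`'s ★★★★ keyed on the record row `bg`, the junction hJ at
separated indices, the print-void residue hNS at non-separated indices; conclusion VERBATIM (no row on the witness). [cite: Balaban1988Convergent, Theorem p.245, Thm 1 p.262, (2.1) p.254, (2.7) p.255, (2.10) p.256, (2.28) p.259, (3.24)–(3.25) p.270; Balaban1985RegularSpaces, (1.3)–(1.6) p.77] -/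
theorem exists_local_witness_clause_succ_of_hasSect2FormAtZS_of_borelB_of_sep_of_sepJunction (hsep : θ.Provisos₁₃SepCoPH F N) (hU : θ.ZhUnity F N)
    (hθ : θ.Admissible F N) (hpos : θ.s2.Pos) {k : ℕ} (hk : k < p.K) (hM : 1 ≤ θ.τ9.M) (hw : Step.InInterval θ.γ k (gOfRecord₁₃ F N θ.toStage13Params p))
    (hPC : PartCompat₁₃ F N θ.toStage13Params p k) (cR : ℝ)
    (Γr : SeqOfRecord F θ.ν θ.τ9.M (gOfRecord₁₃ F N θ.toStage13Params p) p.K k → ℕ → Set (Site (F.P p.K) 0) → Set (Site (F.P p.K) 0))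
    (hreg : ∀ s₀, (θ.zhAt p s₀).RegOn F N (FluctV N) θ.ν cR p (gOfRecord₁₃ F N θ.toStage13Params p) (Γr s₀))
    (hJ : ∀ s₀, Sect2.SeqSeparated θ.ν.M₁ s₀ → ∀ Wc : MSField (F.P p.K) (SU N),
      chiSeqOfRecord F N θ.ν θ.τ9.M (gOfRecord₁₃ F N θ.toStage13Params p) p.K k s₀ (Wc k) ≠ 0 →
      (∀ j, j < k → PlaqSmallOn (plaqsOf (pts j (Γr s₀ j (s₀.Ω (j + 1))ᶜ))) (cR * epsOfRecord θ.ν (gOfRecord₁₃ F N θ.toStage13Params p) j) (Wc j)) →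
      Wc ∈ suppOfRecord₁₃SepCoP F N θ.toStage13Params p k s₀)
    (hNS : ∀ s₀, ¬ Sect2.SeqSeparated θ.ν.M₁ s₀ → ∀ Wc : MSField (F.P p.K) (SU N),
      chiSeqOfRecord F N θ.ν θ.τ9.M (gOfRecord₁₃ F N θ.toStage13Params p) p.K k s₀ (Wc k) ≠ 0 →
      (∀ j, j < k → PlaqSmallOn (plaqsOf (pts j (Γr s₀ j (s₀.Ω (j + 1))ᶜ))) (cR * epsOfRecord θ.ν (gOfRecord₁₃ F N θ.toStage13Params p) j) (Wc j)) →
      ∀ j, 1 ≤ j → j ≤ k → ∀ X : (Sect2.domSys (F.P p.K) θ.τ9.M j).Dom,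
        (Sect2.domSites (F.P p.K) θ.τ9.M j X ⊆ s₀.Λ j →
          Sect2.ofBackgroundC (settingOfRecord₁₃ F N θ.toStage13Params p).ι (UbgOfRecord₁₃CoP F N θ.toStage13Params p k s₀ Wc) ∈
            Sect2.spaceI (settingOfRecord₁₃ F N θ.toStage13Params p) (θ.Rz p.K) θ.τ9.M j (Sect2.domSites (F.P p.K) θ.τ9.M j X)
              ((settingOfRecord₁₃ F N θ.toStage13Params p).lf.alpha0 ((settingOfRecord₁₃ F N θ.toStage13Params p).flow.g j))
              ((settingOfRecord₁₃ F N θ.toStage13Params p).lf.alpha1 ((settingOfRecord₁₃ F N θ.toStage13Params p).flow.g j))) ∧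
        (Sect2.admB (F.P p.K) θ.ν θ.τ9.M (gOfRecord₁₃ F N θ.toStage13Params p) s₀.Ω s₀.Λ j (Sect2.domSites (F.P p.K) θ.τ9.M j X) = true →
          Sect2.ofBackgroundC (settingOfRecord₁₃ F N θ.toStage13Params p).ι (UbgOfRecord₁₃CoP F N θ.toStage13Params p k s₀ Wc) ∈
            Sect2.spaceMS (settingOfRecord₁₃ F N θ.toStage13Params p) (θ.Rz p.K) θ.τ9.M j (Sect2.domSites (F.P p.K) θ.τ9.M j X) s₀.Ω))
    (t₀ : SeqOfRecord F θ.ν θ.τ9.M (gOfRecord₁₃ F N θ.toStage13Params p) p.K k → Sect2.TermValues (F.P p.K) (MatA N) (FluctV N) θ.τ9.M)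
    (E₀ : SeqOfRecord F θ.ν θ.τ9.M (gOfRecord₁₃ F N θ.toStage13Params p) p.K k → ℝ)
    (hform₀ : HasSect2FormAtZS F N (FluctV N) p.K (settingOfRecord₁₃ F N θ.toStage13Params p) k (θ.rzAt p) (WtOfRecord₁₃H F N θ p)
      (UbgOfRecord₁₃CoP F N θ.toStage13Params p k)
      (fun s₀ t' => Sect2.LawsRT (sect2TowerOfRecord F N (FluctV N) p.K (settingOfRecord₁₃ F N θ.toStage13Params p) (θ.rzAt p s₀) s₀ t')
        (settingOfRecord₁₃ F N θ.toStage13Params p).lf k)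
      (slotsOfRecord F N θ.ν θ.τ9 (EOfRecord₁₃ F N θ.toStage13Params) (wOfRecord₉ F N θ.toStage9Params) θ.ppSel p (gOfRecord₁₃ F N θ.toStage13Params p) k) t₀ E₀)
    (hBt : ∀ s₀ (S' : ℕ → Set (Site (F.P p.K) 0)) (j : ℕ) (X : (Sect2.domSys (F.P p.K) θ.τ9.M j).Dom),
      Measurable (fun q : GaugeField (F.P p.K) 0 (SU N) × MSFluct (F.P p.K) (FluctV N) =>
        (t₀ s₀).B j X (Sect2.ofBackgroundC (settingOfRecord₁₃ F N θ.toStage13Params p).ι q.1) (S', q.2))) :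
    ∃ (t : SeqOfRecord F θ.ν θ.τ9.M (gOfRecord₁₃ F N θ.toStage13Params p) p.K k → Sect2.TermValues (F.P p.K) (MatA N) (FluctV N) θ.τ9.M)
      (Ek : SeqOfRecord F θ.ν θ.τ9.M (gOfRecord₁₃ F N θ.toStage13Params p) p.K k → ℝ),
      HasSect2FormAtZS F N (FluctV N) p.K (settingOfRecord₁₃ F N θ.toStage13Params p) k (θ.rzAt p) (WtOfRecord₁₃H F N θ p)
          (UbgOfRecord₁₃CoP F N θ.toStage13Params p k)
          (fun s₀ t₀ => Sect2.LawsRT (sect2TowerOfRecord F N (FluctV N) p.K (settingOfRecord₁₃ F N θ.toStage13Params p) (θ.rzAt p s₀) s₀ t₀)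
            (settingOfRecord₁₃ F N θ.toStage13Params p).lf k)
          (slotsOfRecord F N θ.ν θ.τ9 (EOfRecord₁₃ F N θ.toStage13Params) (wOfRecord₉ F N θ.toStage9Params) θ.ppSel p
            (gOfRecord₁₃ F N θ.toStage13Params p) k) t Ek ∧
      (∀ s₀, IsFluctLocal k (t s₀)) ∧
      ∀ (s : SeqOfRecord F θ.ν θ.τ9.M (gOfRecord₁₃ F N θ.toStage13Params p) p.K (k + 1)), s.Ω (k + 1) = ∅ →
        -- (P) prefix agreement below `k`
        (∀ j, j < k → (θ.zhAt p s).ζ0 j = (θ.zhAt p s.init).ζ0 j ∧ (θ.zhAt p s).quad j = (θ.zhAt p s.init).quad j) →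
        -- (V) the generation-`k` pin with the old front factor
        (∀ (V' : GaugeField (F.P p.K) (k + 1) (SU N)) (U₀ : GaugeField (F.P p.K) k (SU N)),
          (θ.zhAt p s).ζ0 k Set.univ (pairCfgAt (V := FluctV N) k V' U₀) =
            chiSeqOfRecord F N θ.ν θ.τ9.M (gOfRecord₁₃ F N θ.toStage13Params p) p.K k s.init U₀ *
              wOfRecord₉ F N θ.toStage9Params p (gOfRecord₁₃ F N θ.toStage13Params p) k s U₀ ((avOfRecord F N p.K k).avg U₀)) →
        -- `quad_k(∅) = 0` on the two-scale configurations
        (∀ (V' : GaugeField (F.P p.K) (k + 1) (SU N)) (U₀ : GaugeField (F.P p.K) k (SU N)), (θ.zhAt p s).quad k ∅ (pairCfgAt (V := FluctV N) k V' U₀) = 0) →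
        -- `k`-locality of `quad_j(Λ_{j+1})`, `j < k`
        (∀ j, j < k → ∀ ω ω' : MultiCfg (F.P p.K) (SU N) (FluctV N), (∀ i, i ≤ k → ω i = ω' i) →
          (θ.zhAt p s).quad j (s.init.Λ (j + 1)) ω = (θ.zhAt p s).quad j (s.init.Λ (j + 1)) ω') →
        -- measurability of the residual serving `s′`
        (∀ j (Y : Set (Site (F.P p.K) 0)), Measurable ((θ.zhAt p s).ζ0 j Y)) →
        (∀ j (Λ' : Set (Site (F.P p.K) 0)), Measurable ((θ.zhAt p s).quad j Λ')) →
        -- per old branch: A-fibre domination (K0b)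
        (∀ S ∈ admSOfRecord F θ.ν θ.τ9.M (gOfRecord₁₃ F N θ.toStage13Params p) p.K k s.init, ∀ j : ℕ,
          ∃ ŵ : (↥(Set.toFinite (B10Eq42TorusConstraint.bondsIn j ((s.init.Λ (j + 1))ᶜ ∩ s.init.Ω (j + 1)))).toFinset → FluctV N) → ℝ≥0∞, Measurable ŵ ∧
            (∫⁻ a, ŵ a ∂(Measure.pi fun _ : ↥(Set.toFinite (B10Eq42TorusConstraint.bondsIn j ((s.init.Λ (j + 1))ᶜ ∩ s.init.Ω (j + 1)))).toFinset => (volume : Measure (FluctV N)))) ≠ ⊤ ∧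
            ∀ ω, ENNReal.ofReal ((WtOfRecord₁₃H F N θ p s).w j (s.init.Λ (j + 1)) ((s.init.Λ (j + 1))ᶜ ∩ s.init.Ω (j + 1)) (S (j + 1)) ω) ≤
              ŵ (fun b : ↥(Set.toFinite (B10Eq42TorusConstraint.bondsIn j ((s.init.Λ (j + 1))ᶜ ∩ s.init.Ω (j + 1)))).toFinset => (ω j).2 b)) →
        (slotsTOfRecord F N θ.ν θ.τ9 (EOfRecord₁₃ F N θ.toStage13Params) (wOfRecord₉ F N θ.toStage9Params) θ.ppSel p
            (gOfRecord₁₃ F N θ.toStage13Params p) (k + 1) s = 0 ∨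
          ∀ᵐ V' ∂fieldMeasure (F.P p.K) (k + 1) (SU N),
            chiSeqOfRecord F N θ.ν θ.τ9.M (gOfRecord₁₃ F N θ.toStage13Params p) p.K (k + 1) s V' ≠ 0 →
              slotsTOfRecord F N θ.ν θ.τ9 (EOfRecord₁₃ F N θ.toStage13Params) (wOfRecord₉ F N θ.toStage9Params) θ.ppSel p
                  (gOfRecord₁₃ F N θ.toStage13Params p) (k + 1) s V' =
                sect2Slot F N (FluctV N) p.K (settingOfRecord₁₃ F N θ.toStage13Params p) (θ.rzAt p s) (WtOfRecord₁₃H F N θ p s) s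
                  (t s.init) (Ek s.init) (UbgOfRecord₁₃CoP F N θ.toStage13Params p (k + 1) s) V') :=
  exists_local_witness_clause_succ_of_hasSect2FormAtZS_of_borelB_of_bgRead θ p hsep.toCore hU hθ hpos hk hM hw cR Γr hreg
    (bgProvisoΛ_read_of_sep_of_junction_of_nonSep θ p cR Γr (hsep.bg p k hk.le hw hPC) hJ hNS) t₀ E₀ hform₀ hBt

/-! ## The junction at separated indices, for print's reading regions, REDUCED TO ITS TOP-SCALE PART -/

/-- **THE JUNCTION AT SEPARATED INDICES IS A TOP-SCALE STATEMENT** (`1 ≤ k`, print's reading regions `Γr s₀ := readSelOfSeq (suppDom) s₀.Ω`, threshold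
letter `cR := θ.s2.cR`): the lower clauses of the reading support ARE the scale-`0` collar clause (`readSelOfSeq_zero_compl`, `pts_zero`) and the clauses
`1 ≤ j < k` (`readSelOfSeq_compl_eq_gammaRegion`, `genSet`) of def-R's separated (7)-regular support; what the junction adds is the TOP clause «`χ_k(s₀)(W_k) ≠ 0 ⇒
|W_k(∂q) − 1| < cR·ε_k` on `Γ_k = Ω_k^{(k)}`» and the (7)-data `DataSmall7PTop` — def-R's located R-half of [RFACE-11d] ([15] Thm 1 + [B7] Prop. 2 on the solvable set),
DISPLAYED as `hTop`.  (At `k = 0` no background proviso is read at all: `bgProvisoΛ_of_eq_zero`.) [cite: Balaban1988Convergent, (2.2) p.255, (2.10) p.256, (2.17) p.257, (2.28) p.259; Balaban1985RegularSpaces, (1.3)–(1.6) p.77; Balaban1985Variational, (7) p.278] -/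
theorem sepJunction_of_top {k : ℕ} (hk : 1 ≤ k)
    (hTop : ∀ s₀ : SeqOfRecord F θ.ν θ.τ9.M (gOfRecord₁₃ F N θ.toStage13Params p) p.K k, Sect2.SeqSeparated θ.ν.M₁ s₀ → ∀ Wc : MSField (F.P p.K) (SU N),
      chiSeqOfRecord F N θ.ν θ.τ9.M (gOfRecord₁₃ F N θ.toStage13Params p) p.K k s₀ (Wc k) ≠ 0 →
      (∀ j, j < k → PlaqSmallOn (plaqsOf (pts j (readSelOfSeq F p (suppDomOfRecord F θ.ν p.K s₀.Ω) s₀.Ω j (s₀.Ω (j + 1))ᶜ)))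
        (θ.s2.cR * epsOfRecord θ.ν (gOfRecord₁₃ F N θ.toStage13Params p) j) (Wc j)) →
      PlaqSmallOn (plaqsOf (genSet s₀.Ω k k)) (θ.s2.cR * epsOfRecord θ.ν (gOfRecord₁₃ F N θ.toStage13Params p) k) (Wc k) ∧
        Sect2.DataSmall7PTop (avOfRecord F N p.K) s₀.Ω (suppDomOfRecord F θ.ν p.K s₀.Ω) k
          (fun j => θ.s2.cR * epsOfRecord θ.ν (gOfRecord₁₃ F N θ.toStage13Params p) j) Wc) :
    ∀ s₀ : SeqOfRecord F θ.ν θ.τ9.M (gOfRecord₁₃ F N θ.toStage13Params p) p.K k, Sect2.SeqSeparated θ.ν.M₁ s₀ → ∀ Wc : MSField (F.P p.K) (SU N),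
      chiSeqOfRecord F N θ.ν θ.τ9.M (gOfRecord₁₃ F N θ.toStage13Params p) p.K k s₀ (Wc k) ≠ 0 →
      (∀ j, j < k → PlaqSmallOn (plaqsOf (pts j (readSelOfSeq F p (suppDomOfRecord F θ.ν p.K s₀.Ω) s₀.Ω j (s₀.Ω (j + 1))ᶜ)))
        (θ.s2.cR * epsOfRecord θ.ν (gOfRecord₁₃ F N θ.toStage13Params p) j) (Wc j)) →
      Wc ∈ suppOfRecord₁₃SepCoP F N θ.toStage13Params p k s₀ := by
  intro s₀ hs Wc hχ hlow
  obtain ⟨htop, h7⟩ := hTop s₀ hs Wc hχ hlow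
  refine (mem_suppOfRecord₁₃SepCoP_iff F N θ.toStage13Params p k s₀ Wc).mpr ⟨⟨?_, fun j h1 hj => ?_⟩, hs, h7⟩
  · have h0 := hlow 0 hk
    rw [readSelOfSeq_zero_compl, pts_zero] at h0
    exact h0
  · rcases Nat.lt_or_eq_of_le hj with hlt | rfl
    · have h1' := hlow j hlt
      rw [readSelOfSeq_compl_eq_gammaRegion _ _ h1 hlt] at h1'
      exact h1'
    · exact htop

end Summit.QuantumFields.YangMills.Theorems.BalabanUVNodesN11SpaceTruncationAtSepIndices

end
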